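import Summits.QuantumFields.YangMills.Theorems.UnitScaleTiltProp7HSplitDOfPairing
import Summits.QuantumFields.YangMills.Theorems.UnitScaleTiltProp7LandauTransversalityRows
import Summits.QuantumFields.YangMills.Theorems.UnitScaleTiltProp7GaugeDirVelocityDefect
import Summits.QuantumFields.YangMills.Theorems.UnitScaleTiltProp7FibreELOfCritSplit
import Summits.QuantumFields.YangMills.Theorems.UnitScaleTiltProp7NMax19Algebra
import HarnessLib

/-!
# Route `UnitScaleTilt`, crux K1 child «MinimiserStabilityRegPr» (stmt-QuantumFields-19200), skeleton v10, stub `stub_existenceMinimalOrbit` (EX), route (α) —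
# **THE EX DISPLAY'S ROW `hSplit′`∕`hSplitD` FROM THE FIVE DISPLAYED ROWS OF PLAN v2, AT THE CONSUMER'S CHART LETTERS**: the chart-level knit
# ★★★`hSplitD_of_rows` = ✓`Prop7HSplitDOfPairing.hSplitD_of_pairing` (★w4 g7: (P1) ⊕ (P2) ⇐ ONE complex pairing test + `RegPr U′` + `hU′`) ∘
# ✓`Prop7LandauTransversalityPairing.htest_of_rows` (★w5 g7: the pairing test ⇐ (Poincaré), (H-Z), (T-small), (Q4-H²), (T), (D*), (M onto) + an L-only window) with the
# table's two «knitter» slots and the door's two chart inputs DISCHARGED here from the consumer's own data (`hX`, `hAX : χ(A′) = iX`, `hsize : nMax19 U₀ X < e`, `hw137`):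
# (D*) by ✓`Prop7GaugeDirRotationDivergence.norm_DstarL2_transfer_le` at `A := χ(A′)` with rate `a′ := 56e` (the (19)-rows of `χ(A′)` READ OFF `nMax19 U₀ X < e`), (M onto) by
# ✓`isUnit_gSer_ad_neg`, `RegPr (178(ε₀ + e)) U′` by ✓`in19_expHermField_of_nMax19_lt` ∘ ✓`regPr_emb15_of_in19`, `hU′` by ✓`coe_emb15_expHermField` — so that the EX knit's
# `hSplit′` row reads `hSplitD_of_rows … hT hQ4 hKT hPoinc hHZ` from FIVE named rows and ONE numeric window, nothing else.

Cell `ym3-torus`, width seat `ym-ust-20520-w4` (gen 8).  THEOREMS ONLY (0 `def`, 0 `sorry`).  `--supports stmt-QuantumFields-19200 --as helper`, count-neutral.  YM₃ on T³ is a ladder rung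
(R3), not the Clay problem; nothing here claims the stub, the crux, d = 4 or the mass gap.

WHAT IS PROVED (member `F`, `h : n ≤ K`; sorry-free, no definition; ns `…Theorems.Prop7HSplitDOfRows`):
* §1 ★`hDstar_of_nMax19_le` — the (D*) row of ✓`htest_of_rows` at ANY bond field `A` of (19)-size `nMax19 U₀ A ≤ e`, `10⁹L²e ≤ 1`, with `a′ := 56e`: for every `N, w` with
  `g(ad(−A(b)))w(b) = N(b₋) − e^{A(b)}(U₀(b)N(b₊)U₀(b)⋆)e^{−A(b)}`, `‖D*_{U₀}(toL2 w + η·D_{U₀}(toL2S N))‖ ≤ η·(56e)·(‖toL2S N‖ + ‖D_{U₀}(toL2S N)‖)` (✓`norm_DstarL2_transfer_le` with `ε := e`: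
  `‖A(b)‖ ≤ eη`, `‖(∇¹_{U₀}A)_{μμ}(x)‖ ≤ eη²` by ✓`norm_le_nMax19_mul_eta`∕✓`norm_covGradT_le_nMax19`; `e^{eη}e^{eη} ≤ 2`, `12 + 100e ≤ 28`); `nMax19_chartPoint_eq` — at the chart point
  `nMax19 U₀ χ(A′) = nMax19 U₀ X` (`χ(A′) = iX`, ✓`nMax19_smul_of_norm_eq_one`).
* §2 `surjective_gSer_ad_neg` — (M onto): `‖A₁‖ ≤ ½ ⟹ g(ad(−A₁))` onto (✓`isUnit_gSer_ad_neg` + finite dimension).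
* §3 ★★`htest_at_chart_of_rows` — the complex pairing test of ✓`hSplitD_of_pairing`∕✓`hSplitP2_su2_of_pairing_exp` (supplier's stencil at `A := χ(A′)`, `T := D(log U̿^{twS})(χ(A′))`) from the
  five rows (Poincaré) `hPoinc`, (H-Z) `hHZ`, (T-small) `hKT`, (Q4-H²) `hQ4`, (T) `hT` — stated VERBATIM in ✓`htest_of_rows`' shapes at `M b := g(ad(−χ(A′)(b)))`, `Gd N(b) := N(b₋) −
  e^{χ(A′)(b)}(U₀(b)N(b₊)U₀(b)⋆)e^{−χ(A′)(b)}`, sector `Z` and coarse currency `(Y, Kop, q)` ABSTRACT, constants `C₀ δ P₂` — under the L-only window `2(56e)(P₂ + C₀δ(2P₂)) + C₀δ(2P₂) < 1`.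
* §4 ★★★`hSplitD_of_rows` — the `hSplitD` hypothesis of ✓`Prop7FibreELOfCritSplitD.fibreEL_of_crit_splitD` VERBATIM (at `Sl δ := (Q(U₀)δ = 0 ∧ IsLandauPrintS U₀ δ)`,
  `U′ := emb15 U₀ (expHermField X)`) from the same five rows + window, over that consumer's own binders (`hw137`, `hX`, `hAX`, `hsize`) and the (D47)∕`H`-letter binders of ✓`hSplitD_of_pairing`.
INHABITABILITY (★★OWNER RULING g27-№9 (3)): NO new displayed row — the five rows are ✓`htest_of_rows`' own binders (its inhabitability line applies verbatim: at `χ(A′) = 0` with `Kop := 0`,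
`Y := PUnit`, `q := 0`, `C₀ = δ = 0` the rows (T), (Q4-H²), (T-small) hold trivially and the window reads `112e·P₂ < 1`; (Poincaré) + (H-Z) are R2a's genuine content — ROW-B ✓p663081 ∕ ROW-T ∕
★px20's `hHZ`-algebra); the four discharged slots read no junk value (`e ≤ 10⁻⁹L⁻²`).
HONEST SCOPE.  A composition of landed theorems plus `L²`∕(19)-size bookkeeping with crude integer constants; the five rows are HYPOTHESES whose suppliers are the named plan-v2 files (ROW-B∕ROW-T
★px20∕★px11, (H-Z) planner∕★px20, R2t ★px6, R2q″ ★px10 + ★w5 FILE 3, ROW-G ★px10); nothing of EX, the crux, N06(d = 3) or the gap is proved or claimed.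

References: T. Bałaban, CMP 102 (1985) 277–309 [Balaban1985Variational] ((19) p.281, (44)–(51) pp.285–286, (82)–(83) p.290, Prop. 3 p.289, (112) p.294); CMP 99 (1985) 389–434
[Balaban1985BackgroundPropagators] ((3.3) p.391, (3.8) p.392, (3.13)–(3.15) p.393, (3.20)–(3.23) p.394, (3.115) p.418); CMP 98 (1985) 17–51 [Balaban1985Averaging] ((32)–(34) pp.22–23,
(97) p.32); CMP 99 (1985) 75–102 [Balaban1985RegularSpaces] (Sect. D pp.89–95, Prop. 7 p.98).
-/

set_option autoImplicit false

noncomputable section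

open scoped InnerProductSpace Matrix.Norms.L2Operator Matrix
open Filter Metric NormedSpace

namespace Summit.QuantumFields.YangMills.Theorems.Prop7HSplitDOfRows

open Literature.Analysis.Calculus.ExpDifferential (ad gSer)
open Literature.MathematicalPhysics.QuantumFieldTheory.Balaban1983to89
open Literature.MathematicalPhysics.QuantumFieldTheory.Balaban1983to89.T3ContinuumYM3Torus
open T3PrintedRegularMinimiser (RegPr)
open T3SectALandauChart (In19 emb15 eta eta_pos bgUnits covGradT)
open B11Prop3Model (Dfix)
open B11Eq103H1Complex (SiteL2K BondL2K)
open Summit.QuantumFields.YangMills.Theorems.Prop7SectET3Transport (periodsT3)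
open Summit.QuantumFields.YangMills.Theorems.Prop7SymAvgTwSym (logChartTwS QTwS CmapTwS Chart47T3twS)
open Summit.QuantumFields.YangMills.Theorems.Prop7SymAvgGL (QSym)
open Summit.QuantumFields.YangMills.Theorems.Prop7SectET3HilbertLetters (W₂ toL2 toL2S DL2 DstarL2 covLapSite)
open Summit.QuantumFields.YangMills.Theorems.Prop7SectET3GaugeProjector (NS)
open Summit.QuantumFields.YangMills.Theorems.Prop7SPrint (IsLandauPrintS)
open Summit.QuantumFields.YangMills.Theorems.Prop7TPrint (nMax19 expHermField)
open Summit.QuantumFields.YangMills.Theorems.Prop7NMax19Algebra (norm_le_nMax19_mul_eta norm_covGradT_le_nMax19 nMax19_smul_of_norm_eq_one)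
open Summit.QuantumFields.YangMills.Theorems.Prop7ChartVelocityDexp (isUnit_gSer_ad_neg)
open Summit.QuantumFields.YangMills.Theorems.Prop7GaugeDirRotationDivergence (norm_DstarL2_transfer_le)
open Summit.QuantumFields.YangMills.Theorems.Prop7LandauTransversalityMarginSU2Chart (injective_of_isUnit chartPoint_su2_norm)
open Summit.QuantumFields.YangMills.Theorems.Prop7LandauTransversalityPairing (htest_of_rows)
open Summit.QuantumFields.YangMills.Theorems.Prop7HSplitDOfPairing (hSplitD_of_pairing)
open Summit.QuantumFields.YangMills.Theorems.Prop7FibreELOfCritSplit (coe_emb15_expHermField)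
open Summit.QuantumFields.YangMills.Theorems.Prop7B8Prop7Div (regPr_emb15_of_in19)
open Summit.QuantumFields.YangMills.Theorems.Prop7PV3CDELogChart (in19_expHermField_of_nMax19_lt)

variable (F : T3Family) {n K : ℕ} (h : n ≤ K)

/-! ## §1 The (D*) row at a bond field of (19)-size `≤ e`, and the (19)-size of the chart point -/

/-- ★ **THE (D*) ROW OF ✓`htest_of_rows` AT ANY BOND FIELD OF (19)-SIZE `nMax19 U₀ A ≤ e`, `10⁹L²e ≤ 1`, WITH RATE `a′ := 56e`**: for every `N, w` with `g(ad(−A(b)))w(b) = N(b₋) −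
e^{A(b)}(U₀(b)N(b₊)U₀(b)⋆)e^{−A(b)}` bondwise, `‖D*_{U₀}(toL2 w + η·D_{U₀}(toL2S N))‖ ≤ η·(56e)·(‖toL2S N‖ + ‖D_{U₀}(toL2S N)‖)`.  Proof: ✓`norm_DstarL2_transfer_le` (★w5-20520 g7) with `ε := e`
— its two (19)-clauses `‖A(b)‖ ≤ eη`, `‖(∇¹_{U₀}A)_{μμ}(x)‖ ≤ eη²` are ✓`norm_le_nMax19_mul_eta`∕✓`norm_covGradT_le_nMax19`, `eη ≤ ¼` since `e ≤ 10⁻⁹` — then `e^{eη}e^{eη} ≤ 2` and `12 + 100e ≤ 28`.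
[cite: Balaban1985BackgroundPropagators, (3.3) p.391, (3.8) p.392; Balaban1985Variational, (19) p.281, (47)–(49) p.285] -/
theorem hDstar_of_nMax19_le {c₀ : ℝ} [Fact (0 < c₀)] (U₀ : GaugeField (F.P K) 0 (Matrix.specialUnitaryGroup (Fin 2) ℂ))
    (A : PBond (F.P K) 0 → Matrix (Fin 2) (Fin 2) ℂ) {e : ℝ} (he : 0 ≤ e) (hA : nMax19 F n K U₀ A ≤ e) (hWe : 10 ^ 9 * (F.L : ℝ) ^ 2 * e ≤ 1) :
    ∀ (N : Site (F.P K) 0 → Matrix (Fin 2) (Fin 2) ℂ) (w : PBond (F.P K) 0 → Matrix (Fin 2) (Fin 2) ℂ),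
      (∀ b, gSer ℂ (ad ℂ (-(A b))) (w b) = N b.src - exp (A b) * (((U₀ b : Matrix.specialUnitaryGroup (Fin 2) ℂ) : Matrix (Fin 2) (Fin 2) ℂ) * N b.tgt *
        star (((U₀ b) : Matrix.specialUnitaryGroup (Fin 2) ℂ) : Matrix (Fin 2) (Fin 2) ℂ)) * exp (-(A b))) →
      ‖DstarL2 F n K c₀ U₀ (toL2 F K c₀ w + ((eta F n K : ℝ) : ℂ) • DL2 F n K c₀ U₀ (toL2S F K c₀ N))‖
        ≤ eta F n K * (56 * e) * (‖toL2S F K c₀ N‖ + ‖DL2 F n K c₀ U₀ (toL2S F K c₀ N)‖) := by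
  intro N w hw
  have hη : 0 < eta F n K := eta_pos F n K
  have hL1 : (1 : ℝ) ≤ (F.L : ℝ) := by exact_mod_cast F.hL.2.le
  have hη1 : eta F n K ≤ 1 := by
    show ((F.L : ℝ)⁻¹) ^ (K - n) ≤ 1
    exact pow_le_one₀ (inv_nonneg.2 (by positivity)) (inv_le_one_of_one_le₀ hL1)
  have hL2 : (1 : ℝ) ≤ (F.L : ℝ) ^ 2 := one_le_pow₀ hL1
  have he9 : e ≤ 1 / 10 ^ 9 := by
    have h1 : e ≤ (F.L : ℝ) ^ 2 * e := le_mul_of_one_le_left he hL2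
    have h2 : (F.L : ℝ) ^ 2 * e ≤ 1 / 10 ^ 9 := by rw [le_div_iff₀ (by positivity)]; linarith
    exact h1.trans h2
  have heη9 : e * eta F n K ≤ 1 / 10 ^ 9 := (mul_le_of_le_one_right he hη1).trans he9
  have heη0 : 0 ≤ e * eta F n K := mul_nonneg he hη.le
  have heη : e * eta F n K ≤ 1 / 4 := by linarith
  have hA0 : ∀ b, ‖A b‖ ≤ e * eta F n K := fun b =>
    (norm_le_nMax19_mul_eta U₀ A b).trans (mul_le_mul_of_nonneg_right hA hη.le)
  have hA1 : ∀ (μ : Fin 3) (x : Site (F.P K) 0), ‖covGradT 1 (bgUnits F K U₀) A μ μ x‖ ≤ e * eta F n K ^ 2 := fun μ x =>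
    (norm_covGradT_le_nMax19 U₀ A μ μ x).trans (mul_le_mul_of_nonneg_right hA (pow_pos hη 2).le)
  refine (norm_DstarL2_transfer_le F U₀ A he hA0 heη hA1 N w hw).trans ?_
  set a : ℝ := ‖toL2S F K c₀ N‖ with ha
  set d : ℝ := ‖DL2 F n K c₀ U₀ (toL2S F K c₀ N)‖ with hd
  have ha0 : 0 ≤ a := norm_nonneg _
  have hd0 : 0 ≤ d := norm_nonneg _
  -- `e^{eη}e^{eη} ≤ 2`
  have hX1 : Real.exp (e * eta F n K) ≤ 1 + 2 * (1 / 10 ^ 9) := by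
    have h1 : |e * eta F n K| ≤ 1 := by rw [abs_of_nonneg heη0]; linarith
    have h2 := Real.abs_exp_sub_one_le h1
    rw [abs_of_nonneg heη0] at h2
    have h3 := (abs_le.1 h2).2
    linarith
  have hX0 : 0 ≤ Real.exp (e * eta F n K) := (Real.exp_pos _).le
  have hX : Real.exp (e * eta F n K) * Real.exp (e * eta F n K) ≤ 2 := by nlinarith
  have h28 : 12 + 100 * e ≤ 28 := by linarith
  calc Real.exp (e * eta F n K) * Real.exp (e * eta F n K) * e * eta F n K * ((12 + 100 * e) * a + 28 * d)
      ≤ 2 * e * eta F n K * (28 * a + 28 * d) := by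
        have h1 : (12 + 100 * e) * a + 28 * d ≤ 28 * a + 28 * d := by nlinarith
        have h2 : 0 ≤ (12 + 100 * e) * a + 28 * d := by positivity
        calc Real.exp (e * eta F n K) * Real.exp (e * eta F n K) * e * eta F n K * ((12 + 100 * e) * a + 28 * d)
            = (Real.exp (e * eta F n K) * Real.exp (e * eta F n K)) * (e * eta F n K) * ((12 + 100 * e) * a + 28 * d) := by ring
          _ ≤ 2 * (e * eta F n K) * (28 * a + 28 * d) := by gcongr
          _ = 2 * e * eta F n K * (28 * a + 28 * d) := by ring
    _ = eta F n K * (56 * e) * (a + d) := by ring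

/-- **THE (19)-SIZE OF THE CHART POINT**: `χ(A′) = iX` ⟹ `nMax19 U₀ χ(A′) = nMax19 U₀ X` (unit scalar, ✓`nMax19_smul_of_norm_eq_one`). [cite: Balaban1985Variational, (19) p.281, (112) p.294] -/
theorem nMax19_chartPoint_eq (U₀ : GaugeField (F.P K) 0 (Matrix.specialUnitaryGroup (Fin 2) ℂ)) {A₁ X : PBond (F.P K) 0 → Matrix (Fin 2) (Fin 2) ℂ}
    (hAX : A₁ = fun b' => Complex.I • X b') : nMax19 F n K U₀ A₁ = nMax19 F n K U₀ X := by
  have h1 : A₁ = Complex.I • X := by rw [hAX]; rfl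
  rw [h1]
  exact nMax19_smul_of_norm_eq_one U₀ Complex.norm_I X

/-! ## §2 (M onto) -/

/-- **(M onto)**: for `‖A₁‖ ≤ ½` the velocity map `g(ad(−A₁))` of `M₂(ℂ)` is onto (a unit, ✓`isUnit_gSer_ad_neg`, hence injective; finite dimension).
[cite: Balaban1985Averaging, (32)–(34) pp.22–23] -/
theorem surjective_gSer_ad_neg {A₁ : Matrix (Fin 2) (Fin 2) ℂ} (hA₁ : ‖A₁‖ ≤ 1 / 2) :
    Function.Surjective ((gSer ℂ (ad ℂ (-A₁)) : Matrix (Fin 2) (Fin 2) ℂ →L[ℂ] Matrix (Fin 2) (Fin 2) ℂ)) := by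
  have hinj : Function.Injective ((gSer ℂ (ad ℂ (-A₁)) : Matrix (Fin 2) (Fin 2) ℂ →L[ℂ] Matrix (Fin 2) (Fin 2) ℂ)) :=
    injective_of_isUnit (isUnit_gSer_ad_neg hA₁)
  have hs : Function.Surjective ((gSer ℂ (ad ℂ (-A₁)) : Matrix (Fin 2) (Fin 2) ℂ →L[ℂ] Matrix (Fin 2) (Fin 2) ℂ) : Matrix (Fin 2) (Fin 2) ℂ →ₗ[ℂ] Matrix (Fin 2) (Fin 2) ℂ) :=
    LinearMap.injective_iff_surjective.1 hinj
  exact hs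

/-! ## §3 The complex pairing test at the chart from the five rows -/

/-- ★★ **THE COMPLEX PAIRING TEST AT THE CHART POINT FROM THE FIVE DISPLAYED ROWS OF PLAN v2.**  Data: the (D47) window and `H`-letters of ✓`hSplitD_of_pairing` (`U₀ ∈ 𝔘_k(ε₀)`, `10⁹L²e ≤ 1`,
`10¹²L³ε₀ ≤ 1`, `‖HY‖ ≤ b‖Y‖`, `H` real, `9C₂ˢbε < 1`, `6ε ≤ eη`, `Chart47T3twS`), `A′` skew-Hermitian traceless with `2‖A′‖ < ε` and `χ(A′) = iX`, `nMax19 U₀ X < e`; an abstract sector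
`Z`, coarse currency `(Y, Kop, q)` with `Kop(a − b) = Kop a − Kop b`, constants `C₀, δ ≥ 0`, `P₂ ≥ 1`; the five rows of ✓`htest_of_rows` at `M b := g(ad(−χ(A′)(b)))`, `Gd N(b) := N(b₋) −
e^{χ(A′)(b)}(U₀(b)N(b₊)U₀(b)⋆)e^{−χ(A′)(b)}`, `T := D(log U̿^{twS})(χ(A′))`: (T) `hT`, (Q4-H²) `hQ4`, (T-small) `hKT`, (Poincaré) `hPoinc`, (H-Z) `hHZ`; the window `2(56e)(P₂ + C₀δ(2P₂)) +
C₀δ(2P₂) < 1`.  THEN for every residual `l` (`toL2S l ∈ N_S(U₀)`, `Δ^η_{U₀}l ≠ 0`) there are `N″, w` with `g(ad(−χ(A′)(b)))w(b) = Gd N″(b)`, `D(log U̿^{twS})(χ(A′)) w = 0` and `⟪toL2 w,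
D_{U₀}Δ^η_{U₀} l⟫ ≠ 0` — the `htest` hypothesis of ✓`hSplitD_of_pairing` VERBATIM.  Proof: ✓`htest_of_rows` with (D*) := §1 at `A := χ(A′)` and (M onto) := §2 (`‖χ(A′)(b)‖ ≤ ½`, ✓`chartPoint_su2_norm`).
[cite: Balaban1985BackgroundPropagators, (3.3) p.391, (3.20)–(3.23) p.394, (3.115) p.418; Balaban1985Variational, (19) p.281, (45) p.285, (47)–(51) pp.285–286, (82)–(83) p.290] -/
theorem htest_at_chart_of_rows [Fact (0 < (F.L : ℝ))] [Fact (0 < ((F.L : ℝ)⁻¹) ^ (K - n))] {c₀ cB : ℝ} [Fact (0 < c₀)] [Fact (0 < cB)]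
    {ε₀ e b ε : ℝ} (hε₀ : 0 < ε₀) (he : 0 < e) (hWe : 10 ^ 9 * (F.L : ℝ) ^ 2 * e ≤ 1) (hWε : 10 ^ 12 * (F.L : ℝ) ^ 3 * ε₀ ≤ 1)
    (U₀ : GaugeField (F.P K) 0 (Matrix.specialUnitaryGroup (Fin 2) ℂ)) (hreg : RegPr F n K ε₀ U₀)
    {H : (PBond (F.P n) 0 → Matrix (Fin 2) (Fin 2) ℂ) →ₗ[ℂ] (PBond (F.P K) 0 → Matrix (Fin 2) (Fin 2) ℂ)} (hb : 0 ≤ b) (hHop : ∀ Y, ‖H Y‖ ≤ b * ‖Y‖)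
    (hHR : ∀ Y : PBond (F.P n) 0 → Matrix (Fin 2) (Fin 2) ℂ, (∀ c, star (Y c) = -Y c ∧ (Y c).trace = 0) → ∀ b', star (H Y b') = -H Y b' ∧ (H Y b').trace = 0)
    (hq : 9 * (40 * (2 * (3 * (2 * e + 2700 * (F.L : ℝ) * ε₀))) / (e * eta F n K) ^ 2) * b * ε < 1) (hRε : 6 * ε ≤ e * eta F n K)
    (h47 : Chart47T3twS F n K h (40 * (2 * (3 * (2 * e + 2700 * (F.L : ℝ) * ε₀))) / (e * eta F n K) ^ 2) ε U₀ H)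
    {A' : PBond (F.P K) 0 → Matrix (Fin 2) (Fin 2) ℂ} (hA' : 2 * ‖A'‖ < ε) (hA'R : ∀ b', star (A' b') = -A' b' ∧ (A' b').trace = 0)
    {X : PBond (F.P K) 0 → Matrix (Fin 2) (Fin 2) ℂ}
    (hAX : A' - H (Dfix (CmapTwS F n K h U₀) H (40 * (2 * (3 * (2 * e + 2700 * (F.L : ℝ) * ε₀))) / (e * eta F n K) ^ 2) A') = fun b' => Complex.I • X b')
    (hsize : nMax19 F n K U₀ X < e)
    (Z : (Site (F.P K) 0 → Matrix (Fin 2) (Fin 2) ℂ) → Prop)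
    {Y : Type*} [AddCommGroup Y] (Kop : (Site (F.P K) 0 → Matrix (Fin 2) (Fin 2) ℂ) → Y) (q : Y → ℝ)
    (hKsub : ∀ a b : Site (F.P K) 0 → Matrix (Fin 2) (Fin 2) ℂ, Kop (a - b) = Kop a - Kop b)
    {C₀ δ P₂ : ℝ} (hC₀ : 0 ≤ C₀) (hδ : 0 ≤ δ) (h1 : 1 ≤ P₂)
    (hwin : 2 * (56 * e) * (P₂ + C₀ * δ * (2 * P₂)) + C₀ * δ * (2 * P₂) < 1)
    (hT : ∀ (N' : Site (F.P K) 0 → Matrix (Fin 2) (Fin 2) ℂ) (w : PBond (F.P K) 0 → Matrix (Fin 2) (Fin 2) ℂ),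
      (∀ b, gSer ℂ (ad ℂ (-(A' - H (Dfix (CmapTwS F n K h U₀) H (40 * (2 * (3 * (2 * e + 2700 * (F.L : ℝ) * ε₀))) / (e * eta F n K) ^ 2) A')) b)) (w b) =
        N' b.src - exp ((A' - H (Dfix (CmapTwS F n K h U₀) H (40 * (2 * (3 * (2 * e + 2700 * (F.L : ℝ) * ε₀))) / (e * eta F n K) ^ 2) A')) b) * (((U₀ b : Matrix.specialUnitaryGroup (Fin 2) ℂ) : Matrix (Fin 2) (Fin 2) ℂ) * N' b.tgt
          * star ((U₀ b : Matrix.specialUnitaryGroup (Fin 2) ℂ) : Matrix (Fin 2) (Fin 2) ℂ)) * exp (-(A' - H (Dfix (CmapTwS F n K h U₀) H (40 * (2 * (3 * (2 * e + 2700 * (F.L : ℝ) * ε₀))) / (e * eta F n K) ^ 2) A')) b)) →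
      Kop N' = 0 → fderiv ℂ (logChartTwS F n K h U₀) (A' - H (Dfix (CmapTwS F n K h U₀) H (40 * (2 * (3 * (2 * e + 2700 * (F.L : ℝ) * ε₀))) / (e * eta F n K) ^ 2) A')) w = 0)
    (hQ4 : ∀ m : Y, ∃ N : Site (F.P K) 0 → Matrix (Fin 2) (Fin 2) ℂ, Kop N = m ∧ ‖toL2S F K c₀ N‖ ≤ C₀ * q m ∧
      ‖DL2 F n K c₀ U₀ (toL2S F K c₀ N)‖ ≤ C₀ * q m ∧ ‖covLapSite F n K c₀ U₀ (toL2S F K c₀ N)‖ ≤ C₀ * q m)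
    (hKT : ∀ l₁ : Site (F.P K) 0 → Matrix (Fin 2) (Fin 2) ℂ, toL2S F K c₀ l₁ ∈ NS F n K h c₀ cB U₀ → Z l₁ →
      q (Kop l₁) ≤ δ * (‖toL2S F K c₀ l₁‖ + ‖DL2 F n K c₀ U₀ (toL2S F K c₀ l₁)‖))
    (hPoinc : ∀ l₁ : Site (F.P K) 0 → Matrix (Fin 2) (Fin 2) ℂ, toL2S F K c₀ l₁ ∈ NS F n K h c₀ cB U₀ → Z l₁ →
      ‖toL2S F K c₀ l₁‖ ^ 2 ≤ P₂ * ‖DL2 F n K c₀ U₀ (toL2S F K c₀ l₁)‖ ^ 2)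
    (hHZ : ∀ l : Site (F.P K) 0 → Matrix (Fin 2) (Fin 2) ℂ, toL2S F K c₀ l ∈ NS F n K h c₀ cB U₀ →
      ∃ l₁ : Site (F.P K) 0 → Matrix (Fin 2) (Fin 2) ℂ, toL2S F K c₀ l₁ ∈ NS F n K h c₀ cB U₀ ∧ Z l₁ ∧
        DL2 F n K c₀ U₀ (toL2S F K c₀ l₁) = DL2 F n K c₀ U₀ (toL2S F K c₀ l)) :
    ∀ l : Site (F.P K) 0 → Matrix (Fin 2) (Fin 2) ℂ, toL2S F K c₀ l ∈ NS F n K h c₀ cB U₀ →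
      covLapSite F n K c₀ U₀ (toL2S F K c₀ l) ≠ 0 →
      ∃ (N'' : Site (F.P K) 0 → Matrix (Fin 2) (Fin 2) ℂ) (w : PBond (F.P K) 0 → Matrix (Fin 2) (Fin 2) ℂ),
        (∀ b, gSer ℂ (ad ℂ (-(A' - H (Dfix (CmapTwS F n K h U₀) H (40 * (2 * (3 * (2 * e + 2700 * (F.L : ℝ) * ε₀))) / (e * eta F n K) ^ 2) A')) b)) (w b) =
          N'' b.src - exp ((A' - H (Dfix (CmapTwS F n K h U₀) H (40 * (2 * (3 * (2 * e + 2700 * (F.L : ℝ) * ε₀))) / (e * eta F n K) ^ 2) A')) b) * (((U₀ b : Matrix.specialUnitaryGroup (Fin 2) ℂ) : Matrix (Fin 2) (Fin 2) ℂ) * N'' b.tgt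
            * star ((U₀ b : Matrix.specialUnitaryGroup (Fin 2) ℂ) : Matrix (Fin 2) (Fin 2) ℂ)) * exp (-(A' - H (Dfix (CmapTwS F n K h U₀) H (40 * (2 * (3 * (2 * e + 2700 * (F.L : ℝ) * ε₀))) / (e * eta F n K) ^ 2) A')) b)) ∧
        fderiv ℂ (logChartTwS F n K h U₀) (A' - H (Dfix (CmapTwS F n K h U₀) H (40 * (2 * (3 * (2 * e + 2700 * (F.L : ℝ) * ε₀))) / (e * eta F n K) ^ 2) A')) w = 0 ∧
        ⟪toL2 F K c₀ w, DL2 F n K c₀ U₀ (covLapSite F n K c₀ U₀ (toL2S F K c₀ l))⟫_ℂ ≠ 0 := by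
  have hA'1 : ‖A'‖ < ε := by linarith [norm_nonneg A']
  obtain ⟨-, -, hA₁2⟩ := chartPoint_su2_norm F h hε₀ he hWe hWε U₀ hreg hb hHop hHR hq hRε h47 hA'1 hA'R
  set A₁ : PBond (F.P K) 0 → Matrix (Fin 2) (Fin 2) ℂ :=
    A' - H (Dfix (CmapTwS F n K h U₀) H (40 * (2 * (3 * (2 * e + 2700 * (F.L : ℝ) * ε₀))) / (e * eta F n K) ^ 2) A') with hA₁def
  -- (M onto) and (D*) at the chart point
  have hMs : ∀ b', Function.Surjective ((gSer ℂ (ad ℂ (-A₁ b')) : Matrix (Fin 2) (Fin 2) ℂ →L[ℂ] Matrix (Fin 2) (Fin 2) ℂ)) :=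
    fun b' => surjective_gSer_ad_neg (hA₁2 b')
  have hA₁size : nMax19 F n K U₀ A₁ ≤ e := by rw [nMax19_chartPoint_eq F U₀ hAX]; exact hsize.le
  have hDstar := hDstar_of_nMax19_le F (c₀ := c₀) U₀ A₁ he.le hA₁size hWe
  -- the consumer's letters `M`, `Gd`
  let M : PBond (F.P K) 0 → (Matrix (Fin 2) (Fin 2) ℂ →L[ℂ] Matrix (Fin 2) (Fin 2) ℂ) := fun b' => gSer ℂ (ad ℂ (-A₁ b'))
  have hMdef : ∀ b' x, M b' x = gSer ℂ (ad ℂ (-A₁ b')) x := fun b' x => rfl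
  let Gd : (Site (F.P K) 0 → Matrix (Fin 2) (Fin 2) ℂ) →ₗ[ℂ] (PBond (F.P K) 0 → Matrix (Fin 2) (Fin 2) ℂ) :=
    { toFun := fun N b' => N b'.src - exp (A₁ b') * (((U₀ b' : Matrix.specialUnitaryGroup (Fin 2) ℂ) : Matrix (Fin 2) (Fin 2) ℂ) * N b'.tgt
          * star ((U₀ b' : Matrix.specialUnitaryGroup (Fin 2) ℂ) : Matrix (Fin 2) (Fin 2) ℂ)) * exp (-A₁ b')
      map_add' := fun N N' => by
        funext b'
        simp only [Pi.add_apply, Matrix.mul_add, Matrix.add_mul]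
        abel
      map_smul' := fun z N => by
        funext b'
        simp only [Pi.smul_apply, RingHom.id_apply, smul_sub, Matrix.mul_smul, Matrix.smul_mul] }
  have hGd : ∀ N b', Gd N b' = N b'.src - exp (A₁ b') * (((U₀ b' : Matrix.specialUnitaryGroup (Fin 2) ℂ) : Matrix (Fin 2) (Fin 2) ℂ) * N b'.tgt
      * star ((U₀ b' : Matrix.specialUnitaryGroup (Fin 2) ℂ) : Matrix (Fin 2) (Fin 2) ℂ)) * exp (-A₁ b') := fun N b' => rfl
  -- the rows in the letters `M`, `Gd`
  have hMs' : ∀ b', Function.Surjective (M b') := hMs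
  have hT' : ∀ (N' : Site (F.P K) 0 → Matrix (Fin 2) (Fin 2) ℂ) (w : PBond (F.P K) 0 → Matrix (Fin 2) (Fin 2) ℂ),
      (∀ b', M b' (w b') = Gd N' b') → Kop N' = 0 → fderiv ℂ (logChartTwS F n K h U₀) A₁ w = 0 :=
    fun N' w hw hK => hT N' w (fun b' => by rw [← hMdef, ← hGd]; exact hw b') hK
  have hDstar' : ∀ (N' : Site (F.P K) 0 → Matrix (Fin 2) (Fin 2) ℂ) (w : PBond (F.P K) 0 → Matrix (Fin 2) (Fin 2) ℂ), (∀ b', M b' (w b') = Gd N' b') →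
      ‖DstarL2 F n K c₀ U₀ (toL2 F K c₀ w + ((eta F n K : ℝ) : ℂ) • DL2 F n K c₀ U₀ (toL2S F K c₀ N'))‖
        ≤ eta F n K * (56 * e) * (‖toL2S F K c₀ N'‖ + ‖DL2 F n K c₀ U₀ (toL2S F K c₀ N')‖) :=
    fun N' w hw => hDstar N' w (fun b' => by rw [← hMdef, ← hGd]; exact hw b')
  have ha' : (0 : ℝ) ≤ 56 * e := by positivity
  intro l hl hne
  obtain ⟨N', w, hMw, hTw, hp⟩ :=
    htest_of_rows F U₀ Z (T := fderiv ℂ (logChartTwS F n K h U₀) A₁) M hMs' Gd Kop q hKsub hT' ha' hC₀ hδ h1 hwin hDstar' hQ4 hKT hPoinc hHZ l hl hne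
  exact ⟨N', w, fun b' => by rw [← hMdef, ← hGd]; exact hMw b', hTw, hp⟩

/-! ## §4 `hSplitD` from the five rows -/

/-- ★★★ **`hSplitD` FROM THE FIVE DISPLAYED ROWS OF PLAN v2** — the `hSplitD` hypothesis of ✓`Prop7FibreELOfCritSplitD.fibreEL_of_crit_splitD` VERBATIM at `Sl δ := (Q(U₀)δ = 0 ∧
IsLandauPrintS U₀ δ)`, over that consumer's own binders (`hw137 : 10⁷L³·178(ε₀ + e) ≤ 1`, `X` Hermitian traceless, `χ(A′) = iX`, `nMax19 U₀ X < e`), the (D47)∕`H`-letter binders of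
✓`hSplitD_of_pairing` (`hQH`, `h45L` included) and the five rows (T) `hT`, (Q4-H²) `hQ4`, (T-small) `hKT`, (Poincaré) `hPoinc`, (H-Z) `hHZ` of ✓`htest_of_rows` at the chart letters, window
`2(56e)(P₂ + C₀δ(2P₂)) + C₀δ(2P₂) < 1`: for every Fréchet derivative `D` of `χ` at `A′` and every skew-Hermitian traceless `ξ` with `QSym(e^{iX}U₀)ξ = 0` there are `δ′` skew-Hermitian traceless
with `Q(U₀)δ′ = 0`, `IsLandauPrintS U₀ δ′` and `N` Hermitian traceless with `ξ(b) = g(ad(−χ(A′)(b)))((Dδ′)(b)) + (iN(b₋) − (e^{iX}U₀)(b)·iN(b₊)·(e^{iX}U₀)(b)⋆)`.  Proof: ✓`hSplitD_of_pairing` at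
`U′ := emb15 U₀ (expHermField X)` — `hU′` by ✓`coe_emb15_expHermField`, `RegPr (178(ε₀ + e)) U′` by ✓`in19_expHermField_of_nMax19_lt` ∘ ✓`regPr_emb15_of_in19` — fed by §3.
[cite: Balaban1985Variational, (19) p.281, (44)–(51) pp.285–286, (82)–(83) p.290, Prop. 3 p.289, (112) p.294; Balaban1985BackgroundPropagators, (3.3) p.391, (3.13)–(3.15) p.393, (3.20)–(3.23) p.394, (3.115) p.418; Balaban1985Averaging, (32)–(34) pp.22–23, (97) p.32; Balaban1985RegularSpaces, Sect. D pp.89–95, Prop. 7 p.98] -/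
theorem hSplitD_of_rows [Fact (0 < (F.L : ℝ))] [Fact (0 < ((F.L : ℝ)⁻¹) ^ (K - n))] {c₀ cB : ℝ} [Fact (0 < c₀)] [Fact (0 < cB)]
    {ε₀ e b ε : ℝ} (hε₀ : 0 < ε₀) (he : 0 < e) (hWe : 10 ^ 9 * (F.L : ℝ) ^ 2 * e ≤ 1) (hWε : 10 ^ 12 * (F.L : ℝ) ^ 3 * ε₀ ≤ 1)
    (hw137 : 10 ^ 7 * (F.L : ℝ) ^ 3 * (178 * (ε₀ + e)) ≤ 1)
    (U₀ : GaugeField (F.P K) 0 (Matrix.specialUnitaryGroup (Fin 2) ℂ)) (hreg : RegPr F n K ε₀ U₀)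
    {H : (PBond (F.P n) 0 → Matrix (Fin 2) (Fin 2) ℂ) →ₗ[ℂ] (PBond (F.P K) 0 → Matrix (Fin 2) (Fin 2) ℂ)} (hb : 0 ≤ b) (hHop : ∀ Y, ‖H Y‖ ≤ b * ‖Y‖)
    (hHR : ∀ Y : PBond (F.P n) 0 → Matrix (Fin 2) (Fin 2) ℂ, (∀ c, star (Y c) = -Y c ∧ (Y c).trace = 0) → ∀ b', star (H Y b') = -H Y b' ∧ (H Y b').trace = 0)
    (hq : 9 * (40 * (2 * (3 * (2 * e + 2700 * (F.L : ℝ) * ε₀))) / (e * eta F n K) ^ 2) * b * ε < 1) (hRε : 6 * ε ≤ e * eta F n K)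
    (h47 : Chart47T3twS F n K h (40 * (2 * (3 * (2 * e + 2700 * (F.L : ℝ) * ε₀))) / (e * eta F n K) ^ 2) ε U₀ H) (hQH : ∀ X, QTwS F n K h U₀ (H X) = X)
    (h45L : ∀ Y, IsLandauPrintS F n K h c₀ cB U₀ (H Y))
    {A' : PBond (F.P K) 0 → Matrix (Fin 2) (Fin 2) ℂ} (hA' : 2 * ‖A'‖ < ε) (hA'R : ∀ b', star (A' b') = -A' b' ∧ (A' b').trace = 0)
    {X : PBond (F.P K) 0 → Matrix (Fin 2) (Fin 2) ℂ} (hX : ∀ b, (X b).IsHermitian ∧ (X b).trace = 0)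
    (hAX : A' - H (Dfix (CmapTwS F n K h U₀) H (40 * (2 * (3 * (2 * e + 2700 * (F.L : ℝ) * ε₀))) / (e * eta F n K) ^ 2) A') = fun b' => Complex.I • X b')
    (hsize : nMax19 F n K U₀ X < e)
    (Z : (Site (F.P K) 0 → Matrix (Fin 2) (Fin 2) ℂ) → Prop)
    {Y : Type*} [AddCommGroup Y] (Kop : (Site (F.P K) 0 → Matrix (Fin 2) (Fin 2) ℂ) → Y) (q : Y → ℝ)
    (hKsub : ∀ a b : Site (F.P K) 0 → Matrix (Fin 2) (Fin 2) ℂ, Kop (a - b) = Kop a - Kop b)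
    {C₀ δ P₂ : ℝ} (hC₀ : 0 ≤ C₀) (hδ : 0 ≤ δ) (h1 : 1 ≤ P₂)
    (hwin : 2 * (56 * e) * (P₂ + C₀ * δ * (2 * P₂)) + C₀ * δ * (2 * P₂) < 1)
    (hT : ∀ (N' : Site (F.P K) 0 → Matrix (Fin 2) (Fin 2) ℂ) (w : PBond (F.P K) 0 → Matrix (Fin 2) (Fin 2) ℂ),
      (∀ b, gSer ℂ (ad ℂ (-(A' - H (Dfix (CmapTwS F n K h U₀) H (40 * (2 * (3 * (2 * e + 2700 * (F.L : ℝ) * ε₀))) / (e * eta F n K) ^ 2) A')) b)) (w b) =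
        N' b.src - exp ((A' - H (Dfix (CmapTwS F n K h U₀) H (40 * (2 * (3 * (2 * e + 2700 * (F.L : ℝ) * ε₀))) / (e * eta F n K) ^ 2) A')) b) * (((U₀ b : Matrix.specialUnitaryGroup (Fin 2) ℂ) : Matrix (Fin 2) (Fin 2) ℂ) * N' b.tgt
          * star ((U₀ b : Matrix.specialUnitaryGroup (Fin 2) ℂ) : Matrix (Fin 2) (Fin 2) ℂ)) * exp (-(A' - H (Dfix (CmapTwS F n K h U₀) H (40 * (2 * (3 * (2 * e + 2700 * (F.L : ℝ) * ε₀))) / (e * eta F n K) ^ 2) A')) b)) →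
      Kop N' = 0 → fderiv ℂ (logChartTwS F n K h U₀) (A' - H (Dfix (CmapTwS F n K h U₀) H (40 * (2 * (3 * (2 * e + 2700 * (F.L : ℝ) * ε₀))) / (e * eta F n K) ^ 2) A')) w = 0)
    (hQ4 : ∀ m : Y, ∃ N : Site (F.P K) 0 → Matrix (Fin 2) (Fin 2) ℂ, Kop N = m ∧ ‖toL2S F K c₀ N‖ ≤ C₀ * q m ∧
      ‖DL2 F n K c₀ U₀ (toL2S F K c₀ N)‖ ≤ C₀ * q m ∧ ‖covLapSite F n K c₀ U₀ (toL2S F K c₀ N)‖ ≤ C₀ * q m)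
    (hKT : ∀ l₁ : Site (F.P K) 0 → Matrix (Fin 2) (Fin 2) ℂ, toL2S F K c₀ l₁ ∈ NS F n K h c₀ cB U₀ → Z l₁ →
      q (Kop l₁) ≤ δ * (‖toL2S F K c₀ l₁‖ + ‖DL2 F n K c₀ U₀ (toL2S F K c₀ l₁)‖))
    (hPoinc : ∀ l₁ : Site (F.P K) 0 → Matrix (Fin 2) (Fin 2) ℂ, toL2S F K c₀ l₁ ∈ NS F n K h c₀ cB U₀ → Z l₁ →
      ‖toL2S F K c₀ l₁‖ ^ 2 ≤ P₂ * ‖DL2 F n K c₀ U₀ (toL2S F K c₀ l₁)‖ ^ 2)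
    (hHZ : ∀ l : Site (F.P K) 0 → Matrix (Fin 2) (Fin 2) ℂ, toL2S F K c₀ l ∈ NS F n K h c₀ cB U₀ →
      ∃ l₁ : Site (F.P K) 0 → Matrix (Fin 2) (Fin 2) ℂ, toL2S F K c₀ l₁ ∈ NS F n K h c₀ cB U₀ ∧ Z l₁ ∧
        DL2 F n K c₀ U₀ (toL2S F K c₀ l₁) = DL2 F n K c₀ U₀ (toL2S F K c₀ l)) :
    ∀ D : (PBond (F.P K) 0 → Matrix (Fin 2) (Fin 2) ℂ) →L[ℂ] (PBond (F.P K) 0 → Matrix (Fin 2) (Fin 2) ℂ),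
      HasFDerivAt (fun A : PBond (F.P K) 0 → Matrix (Fin 2) (Fin 2) ℂ =>
        A - H (Dfix (CmapTwS F n K h U₀) H (40 * (2 * (3 * (2 * e + 2700 * (F.L : ℝ) * ε₀))) / (e * eta F n K) ^ 2) A)) D A' →
      ∀ ξ : PBond (F.P K) 0 → Matrix (Fin 2) (Fin 2) ℂ, (∀ b', star (ξ b') = -ξ b' ∧ (ξ b').trace = 0) →
      QSym F n K h (emb15 U₀ (expHermField X)) ξ = 0 →
      ∃ δ' : PBond (F.P K) 0 → Matrix (Fin 2) (Fin 2) ℂ, (∀ b', star (δ' b') = -δ' b' ∧ (δ' b').trace = 0) ∧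
        (QTwS F n K h U₀ δ' = 0 ∧ IsLandauPrintS F n K h c₀ cB U₀ δ') ∧
        ∃ N : Site (F.P K) 0 → Matrix (Fin 2) (Fin 2) ℂ, (∀ x, (N x).IsHermitian ∧ (N x).trace = 0) ∧
          ∀ b' : PBond (F.P K) 0, ξ b' =
            gSer ℂ (ad ℂ (-(A' - H (Dfix (CmapTwS F n K h U₀) H (40 * (2 * (3 * (2 * e + 2700 * (F.L : ℝ) * ε₀))) / (e * eta F n K) ^ 2) A')) b'))
              ((D δ') b')
            + (Complex.I • N b'.src - ((emb15 U₀ (expHermField X) b' : Matrix.specialUnitaryGroup (Fin 2) ℂ) : Matrix (Fin 2) (Fin 2) ℂ) * (Complex.I • N b'.tgt)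
                * star ((emb15 U₀ (expHermField X) b' : Matrix.specialUnitaryGroup (Fin 2) ℂ) : Matrix (Fin 2) (Fin 2) ℂ)) := by
  -- the chart point `U′ := e^{iX}U₀` is printed-regular of radius `178(ε₀ + e)` ([Balaban1985RegularSpaces] Prop. 7 through (19))
  have hL1 : (1 : ℝ) ≤ (F.L : ℝ) := by exact_mod_cast F.hL.2.le
  have hL3 : (1 : ℝ) ≤ (F.L : ℝ) ^ 3 := one_le_pow₀ hL1
  have hε₂ : ε₀ + e ≤ 1 / 4 := by nlinarith
  have h19 : In19 F n K (ε₀ + e) U₀ (expHermField X) X := in19_expHermField_of_nMax19_lt hX (hsize.trans_le (by linarith))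
  have hreg' : RegPr F n K (178 * (ε₀ + e)) (emb15 U₀ (expHermField X)) := regPr_emb15_of_in19 F n K hε₂ (by linarith) hreg h19
  have hε₀' : 0 < 178 * (ε₀ + e) := by positivity
  -- `U′(b) = e^{χ(A′)(b)}U₀(b)`
  have hU' : ∀ b', ((emb15 U₀ (expHermField X) b' : Matrix.specialUnitaryGroup (Fin 2) ℂ) : Matrix (Fin 2) (Fin 2) ℂ) =
      exp ((A' - H (Dfix (CmapTwS F n K h U₀) H (40 * (2 * (3 * (2 * e + 2700 * (F.L : ℝ) * ε₀))) / (e * eta F n K) ^ 2) A')) b') *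
        ((U₀ b' : Matrix.specialUnitaryGroup (Fin 2) ℂ) : Matrix (Fin 2) (Fin 2) ℂ) := fun b' => by
    rw [coe_emb15_expHermField F U₀ hX b', hAX]
  -- the door, fed by §3
  exact hSplitD_of_pairing F h hε₀ he hWe hWε hε₀' hw137 U₀ hreg hb hHop hHR hq hRε h47 hQH h45L hA' hA'R (emb15 U₀ (expHermField X)) hreg' hU'
    (htest_at_chart_of_rows F h hε₀ he hWe hWε U₀ hreg hb hHop hHR hq hRε h47 hA' hA'R hAX hsize Z Kop q hKsub hC₀ hδ h1 hwin hT hQ4 hKT hPoinc hHZ)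

end Summit.QuantumFields.YangMills.Theorems.Prop7HSplitDOfRows

end
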